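import Literature.Computability.QuantumComplexity.GapPRing
import Literature.Computability.Complexity.ParityClosure
import HarnessLib

/-!
# Closure of `GapP` under polynomial-time preprocessing, `P` tests, uniform exponential sums and
uniform polynomial products

Toolkit continuing `GapPRing.lean` (`GapP` is a ring: `add_mem_GapP`, `sub_mem_GapP`,
`mul_mem_GapP`, `two_pow_mem_GapP`, …) with the remaining closure properties of
Fenner–Fortnow–Kurtz 1994, §3, in the form quoted by Fortnow–Rogers 1999, Thm. 2.2:

> "Let `f` be a `GapP` function and `q` a polynomial. Then the following are `GapP` functions:
> (1) `-f(x)`; (2) `Σ_{|y| ≤ q(|x|)} f(⟨x, y⟩)`; (3) `Π_{0 ≤ y ≤ q(|x|)} f(⟨x, y⟩)`."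

These are the two ingredients of Li's theorem "`AWPP` is low for `PP`" (Fortnow–Rogers 1999,
Thm. 3.3; consumer `AWPPAmplification.lean`, `AWPPLowForPP.lean`). In the tree's conventions
(`GapP := #P - #P`, `#P` = exact-length witness counts of a `P` relation, `Counting.lean`; uniform
sums over `{0,1}^{|t v|}` and products over `j < |t v|` for a length function `t ∈ FP`, as in
`ParityClosure.sum_mem_SharpP` / `ParityClosure.prod_mem_SharpP`):

* `comp_mem_GapP` (`g ∘ f` for `f ∈ FP`), `ite_mem_GapP` / `piecewise_mem_GapP` (case distinction
  on a `P` test), `piecewise_mem_SharpP`;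
* **`sum_mem_GapP`**: `v ↦ Σ_{z ∈ {0,1}^{|t v|}} g(⟨v, z⟩)` — both halves summed by
  `ParityClosure.sum_mem_SharpP`;
* **`prod_mem_GapP`**: `v ↦ Π_{j < |t v|} g(⟨v, 1ʲ⟩)` — the only new witness format. With
  `g = a - b` (`a, b ∈ #P`), expand `Π_j (a_j - b_j) = Σ_{c ∈ {0,1}^n} (-1)^{|c|₁} Π_j F(c_j, j)`
  (`F(0, j) = a_j`, `F(1, j) = b_j`; `signedSum_prod_eq`): the pattern `c` of chosen halves is an
  extra witness block, the product over `j` of the chosen half is a `#P` function of `⟨v, c⟩` by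
  `ParityClosure.prod_mem_SharpP` (the half being selected by a bit test in `P`, bit `|u|` of `c`
  read off `⟨⟨v, c⟩, u⟩` by `headBitFn ∘ dropFn`, `exists_bitSel`), and the patterns of even resp. odd weight
  (`OddOnes ∈ P`) are summed separately by `ParityClosure.sum_mem_SharpP`, giving the two `#P` halves
  `E(v) - O(v)` — Fenner–Fortnow–Kurtz's machine "guess which of the two machines to run on each
  factor and accept/reject according to the parity of the number of second halves";
* `two_pow_length_mem_SharpP` / `two_pow_length_mem_GapP`: `v ↦ 2^{|t v|}` for `t ∈ FP`
  (exponentials with an `FP`-computable unary exponent).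

## References

* S. Fenner, L. Fortnow, S. Kurtz, *Gap-definable counting classes*, J. Comput. System Sci. 48
  (1994) 116–148, §3 (closure of `GapP` under subtraction, uniform exponential sums and uniform
  polynomial products).
* L. Fortnow, J. Rogers, *Complexity limitations on quantum computation*, J. Comput. System Sci.
  59 (1999) 240–252 = arXiv:cs/9811023, Thm. 2.2 (the closure properties of `GapP` used for
  Thm. 3.3).
* S. Arora, B. Barak, *Computational Complexity: A Modern Approach*, CUP 2009, Def. 17.2, §17.4.2.
-/

noncomputable section

open Computability Literature.Computability.Complexity Literature.Computability.Cryptography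

namespace Literature.Computability.QuantumComplexity

open Polynomial Finset Literature.Computability.Complexity.TTClosure
  Literature.Computability.Complexity.PPSharpP Literature.Computability.Complexity.Brick
  Literature.Computability.Complexity.Plumb Literature.Computability.Complexity.HashBricks
  Literature.Computability.Complexity.ParityClosure AWPPPP GapPRing

open scoped Classical

namespace GapPClosure

/-! ### Preprocessing and case distinctions -/

/-- **`GapP` is closed under polynomial-time preprocessing**: `g ∈ GapP`, `f ∈ FP ⇒ g ∘ f ∈ GapP`
(both `#P` halves composed with `f`, `comp_mem_SharpP`).
[cite: FennerFortnowKurtz1994, §3 (closure properties of GapP)] -/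
theorem comp_mem_GapP {g : List Bool → ℤ} (hg : g ∈ GapP) {f : List Bool → List Bool} (hf : f ∈ FP) :
    (fun x => g (f x)) ∈ GapP := by
  obtain ⟨a, ha, b, hb, e⟩ := hg
  exact ⟨a ∘ f, comp_mem_SharpP ha hf, b ∘ f, comp_mem_SharpP hb hf, fun x => e (f x)⟩

/-- **Restriction to a `P` set**: `g ∈ GapP`, `A ∈ P ⇒ [v ∈ A]·g(v) ∈ GapP`
(`ParityClosure.ite_mem_SharpP` on both halves). [cite: FennerFortnowKurtz1994, §3 (closure properties of GapP)] -/
theorem ite_mem_GapP {g : List Bool → ℤ} (hg : g ∈ GapP) {A : Language Bool} (hA : A ∈ Classes.P) :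
    (fun v => if v ∈ A then g v else 0) ∈ GapP := by
  obtain ⟨a, ha, b, hb, e⟩ := hg
  refine ⟨fun v => if v ∈ A then a v else 0, ite_mem_SharpP ha hA,
    fun v => if v ∈ A then b v else 0, ite_mem_SharpP hb hA, fun v => ?_⟩
  show (if v ∈ A then g v else 0) =
    ((if v ∈ A then a v else 0 : ℕ) : ℤ) - ((if v ∈ A then b v else 0 : ℕ) : ℤ)
  split_ifs with h
  · exact e v
  · simp

/-- **Case distinction on a `P` test** for `#P`: `[v ∈ A]·φ₁(v) + [v ∉ A]·φ₂(v) ∈ #P`.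
[cite: AroraBarak2009, §17.4.2 eq. (17.5)] -/
theorem piecewise_mem_SharpP {φ₁ φ₂ : List Bool → ℕ} (h₁ : φ₁ ∈ SharpP) (h₂ : φ₂ ∈ SharpP)
    {A : Language Bool} (hA : A ∈ Classes.P) : (fun v => if v ∈ A then φ₁ v else φ₂ v) ∈ SharpP := by
  have hc : Aᶜ ∈ Classes.P := (compl_mem_P_iff (L := A)).2 hA
  have h := add_mem_SharpP (ite_mem_SharpP h₁ hA) (ite_mem_SharpP h₂ hc)
  refine (show (fun v => if v ∈ A then φ₁ v else φ₂ v) =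
      fun v => (if v ∈ A then φ₁ v else 0) + (if v ∈ Aᶜ then φ₂ v else 0) from ?_) ▸ h
  funext v
  have hv' : v ∈ Aᶜ ↔ v ∉ A := memL_compl
  by_cases hv : v ∈ A
  · rw [if_pos hv, if_pos hv, if_neg (fun h' => hv'.1 h' hv), add_zero]
  · rw [if_neg hv, if_neg hv, if_pos (hv'.2 hv), zero_add]

/-- **Case distinction on a `P` test** for `GapP`: `[v ∈ A]·g₁(v) + [v ∉ A]·g₂(v) ∈ GapP`.
[cite: FennerFortnowKurtz1994, §3 (closure properties of GapP)] -/
theorem piecewise_mem_GapP {g₁ g₂ : List Bool → ℤ} (h₁ : g₁ ∈ GapP) (h₂ : g₂ ∈ GapP)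
    {A : Language Bool} (hA : A ∈ Classes.P) : (fun v => if v ∈ A then g₁ v else g₂ v) ∈ GapP := by
  have hc : Aᶜ ∈ Classes.P := (compl_mem_P_iff (L := A)).2 hA
  have h := add_mem_GapP (ite_mem_GapP h₁ hA) (ite_mem_GapP h₂ hc)
  refine (show (fun v => if v ∈ A then g₁ v else g₂ v) =
      fun v => (if v ∈ A then g₁ v else 0) + (if v ∈ Aᶜ then g₂ v else 0) from ?_) ▸ h
  funext v
  have hv' : v ∈ Aᶜ ↔ v ∉ A := memL_compl
  by_cases hv : v ∈ A
  · rw [if_pos hv, if_pos hv, if_neg (fun h' => hv'.1 h' hv), add_zero]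
  · rw [if_neg hv, if_neg hv, if_pos (hv'.2 hv), zero_add]

/-! ### Uniform exponential sums -/

/-- **`GapP` is closed under uniform exponential sums**: for `g ∈ GapP` and `t ∈ FP`,
`v ↦ Σ_{z ∈ {0,1}^{|t v|}} g(⟨v, z⟩)` is in `GapP` (sum the two `#P` halves separately,
`ParityClosure.sum_mem_SharpP`). Fortnow–Rogers' Thm. 2.2(2) sums over `|y| ≤ q(|x|)`; the
exact-length form is the tree's convention (`countWitnesses`).
[cite: FortnowRogers1999JCSS, Thm. 2.2(2) (arXiv numbering)] -/
theorem sum_mem_GapP {g : List Bool → ℤ} (hg : g ∈ GapP) {t : List Bool → List Bool} (ht : t ∈ FP) :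
    (fun v => ∑ z : List.Vector Bool (t v).length, g (boolPair v z.toList)) ∈ GapP := by
  obtain ⟨a, ha, b, hb, e⟩ := hg
  refine ⟨_, sum_mem_SharpP ha ht, _, sum_mem_SharpP hb ht, fun v => ?_⟩
  show ∑ z : List.Vector Bool (t v).length, g (boolPair v z.toList) =
    ((∑ z : List.Vector Bool (t v).length, a (boolPair v z.toList) : ℕ) : ℤ) -
      ((∑ z : List.Vector Bool (t v).length, b (boolPair v z.toList) : ℕ) : ℤ)
  push_cast
  rw [← Finset.sum_sub_distrib]
  exact Finset.sum_congr rfl fun z _ => e _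

/-! ### Exponentials with a unary `FP` exponent -/

/-- The constant `2` is a `#P` function. [cite: AroraBarak2009, Def. 17.2] -/
theorem two_mem_SharpP : (fun _ : List Bool => (2 : ℕ)) ∈ SharpP := by
  have h := two_pow_mem_SharpP (1 : Polynomial ℕ)
  simp only [eval_one, pow_one] at h
  exact h

/-- **`v ↦ 2^{|t v|} ∈ #P` for `t ∈ FP`** (a uniform polynomial product of the constant `2`,
`ParityClosure.prod_mem_SharpP`). [cite: FennerFortnowKurtz1994, §3 (FP ⊆ GapP, exponentials)] -/
theorem two_pow_length_mem_SharpP {t : List Bool → List Bool} (ht : t ∈ FP) :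
    (fun v => 2 ^ (t v).length) ∈ SharpP := by
  have h := prod_mem_SharpP two_mem_SharpP ht
  simp only [prod_const, card_range] at h
  exact h

/-- `v ↦ 2^{|t v|} ∈ GapP` for `t ∈ FP`. [cite: FennerFortnowKurtz1994, §3 (FP ⊆ GapP, exponentials)] -/
theorem two_pow_length_mem_GapP {t : List Bool → List Bool} (ht : t ∈ FP) :
    (fun v => (2 : ℤ) ^ (t v).length) ∈ GapP := by
  have h := sharpP_mem_GapP (two_pow_length_mem_SharpP ht)
  simpa using h

/-! ### Uniform polynomial products -/

/-- **The bit test** `{⟨⟨v, c⟩, u⟩ | c_{|u|} = 1} ∈ P` (read by `headBitFn ∘ dropFn` after a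
fan-out; packaged with its specification, no definition is introduced). [folklore] -/
theorem exists_bitSel : ∃ B : Language Bool, B ∈ Classes.P ∧
    ∀ v c u : List Bool, boolPair (boolPair v c) u ∈ B ↔ c.getD u.length false = true := by
  obtain ⟨sel, hsel⟩ : ∃ f : List Bool → List Bool, f = headBitFn ∘ dropFn ∘ fanoutFn sndF (sndF ∘ fstF) :=
    ⟨_, rfl⟩
  have hselFP : sel ∈ FP := hsel ▸ comp_mem_FP headBitFn_mem_FP (comp_mem_FP dropFn_mem_FP
    (fanoutFn_mem_FP sndF_mem_FP (comp_mem_FP sndF_mem_FP fstF_mem_FP)))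
  have hsel_apply : ∀ w, sel w = [(sndF (fstF w)).getD (sndF w).length false] := fun w => by
    simp only [hsel, Function.comp_apply, fanoutFn_apply, dropFn_boolPair, headBitFn_apply]
    rw [List.headD_eq_head?_getD, List.head?_drop, List.getD_eq_getElem?_getD]
  refine ⟨{w | (sndF (fstF w)).getD (sndF w).length false = true}, ?_, fun v c u => ?_⟩
  · refine mem_P_of_mem_FP hselFP _ fun w => ⟨fun h => ?_, fun h => ?_⟩
    · rw [hsel_apply, show (sndF (fstF w)).getD (sndF w).length false = true from h]
    · rw [hsel_apply]
      have h' : (sndF (fstF w)).getD (sndF w).length false = false := by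
        cases hb : (sndF (fstF w)).getD (sndF w).length false
        · rfl
        · exact absurd hb h
      rw [h']
  · show (sndF (fstF (boolPair (boolPair v c) u))).getD (sndF (boolPair (boolPair v c) u)).length false = true ↔ _
    rw [fstF_boolPair, sndF_boolPair, sndF_boolPair]

/-- **The parity tests** `{⟨v, c⟩ | |c|₁ odd}`, `{⟨v, c⟩ | |c|₁ even} ∈ P` (`OddOnes` on the second
component and its complement). [folklore] -/
theorem exists_parityPat : ∃ Od Ev : Language Bool, Od ∈ Classes.P ∧ Ev ∈ Classes.P ∧
    ∀ v c : List Bool, (boolPair v c ∈ Od ↔ Odd (c.count true)) ∧ (boolPair v c ∈ Ev ↔ ¬ Odd (c.count true)) := by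
  have hOd : (sndF ⁻¹' OddOnes : Language Bool) ∈ Classes.P := preimage_mem_P OddOnes_mem_P sndF_mem_FP
  refine ⟨sndF ⁻¹' OddOnes, (sndF ⁻¹' OddOnes)ᶜ, hOd, (compl_mem_P_iff (L := sndF ⁻¹' OddOnes)).2 hOd,
    fun v c => ⟨?_, ?_⟩⟩
  · show sndF (boolPair v c) ∈ OddOnes ↔ _
    rw [sndF_boolPair, mem_OddOnes]
  · show ¬ (sndF (boolPair v c) ∈ OddOnes) ↔ _
    rw [sndF_boolPair, mem_OddOnes]

/-- **Splitting a sum over `{0,1}^{n+1}` by the first bit.** [folklore] -/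
theorem sum_vector_succ {M : Type*} [AddCommMonoid M] (n : ℕ) (T : List.Vector Bool (n + 1) → M) :
    ∑ c, T c = ∑ b : Bool, ∑ c' : List.Vector Bool n, T (b ::ᵥ c') := by
  let e : Bool × List.Vector Bool n ≃ List.Vector Bool (n + 1) :=
    { toFun := fun p => p.1 ::ᵥ p.2
      invFun := fun v => (v.head, v.tail)
      left_inv := fun p => by simp
      right_inv := fun v => List.Vector.cons_head_tail v }
  rw [← Fintype.sum_equiv e (fun p => T (e p)) T (fun _ => rfl), Fintype.sum_prod_type]
  rfl

/-- **The signed pattern expansion of a product of differences**: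
`Σ_{c ∈ {0,1}^n} (-1)^{|c|₁} Π_{j<n} F(c_j, j) = Π_{j<n} (F(0, j) - F(1, j))`.
[cite: FennerFortnowKurtz1994, §3 (closure of GapP under products, proof)] -/
theorem signedSum_prod_eq : ∀ (n : ℕ) (F : Bool → ℕ → ℤ),
    ∑ c : List.Vector Bool n, (-1 : ℤ) ^ c.toList.count true * ∏ j ∈ range n, F (c.toList.getD j false) j =
      ∏ j ∈ range n, (F false j - F true j)
  | 0, F => by simp
  | n + 1, F => by
    have hterm : ∀ (b : Bool) (c' : List.Vector Bool n),
        (-1 : ℤ) ^ (b ::ᵥ c').toList.count true * ∏ j ∈ range (n + 1), F ((b ::ᵥ c').toList.getD j false) j =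
          ((-1 : ℤ) ^ c'.toList.count true * ∏ j ∈ range n, F (c'.toList.getD j false) (j + 1)) *
            ((if b = true then -1 else 1) * F b 0) := by
      intro b c'
      rw [List.Vector.toList_cons, prod_range_succ' fun j => F ((b :: c'.toList).getD j false) j]
      simp only [List.getD_cons_succ, List.getD_cons_zero]
      cases b
      · rw [List.count_cons_of_ne Bool.false_ne_true, if_neg Bool.false_ne_true]
        ring
      · rw [List.count_cons_self, if_pos rfl]
        ring
    have ih := signedSum_prod_eq n (fun e j => F e (j + 1))
    beta_reduce at ih
    rw [sum_vector_succ, Fintype.sum_bool]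
    simp only [hterm]
    rw [← Finset.sum_mul, ← Finset.sum_mul, ih, prod_range_succ' fun j => F false j - F true j, if_true,
      if_neg Bool.false_ne_true]
    ring

/-- **`GapP` is closed under uniform polynomial products**: for `g ∈ GapP` and `t ∈ FP`,
`v ↦ Π_{j < |t v|} g(⟨v, 1ʲ⟩)` is in `GapP`. With `g = a - b`, `a, b ∈ #P`: the `#P` function
`φ(⟨⟨v, c⟩, 1ʲ⟩) = b(⟨v, 1ʲ⟩)` if `c_j = 1`, `= a(⟨v, 1ʲ⟩)` otherwise (`exists_bitSel`), its uniform
product `P(⟨v, c⟩) = Π_{j < |t v|} φ(⟨⟨v, c⟩, 1ʲ⟩)` (`ParityClosure.prod_mem_SharpP`), and the two sums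
`E(v) = Σ_{c even} P(⟨v, c⟩)`, `O(v) = Σ_{c odd} P(⟨v, c⟩)` (`exists_parityPat`,
`ParityClosure.sum_mem_SharpP`) satisfy `Π_j g(⟨v, 1ʲ⟩) = E(v) - O(v)` (`signedSum_prod_eq`).
Fortnow–Rogers' Thm. 2.2(3) multiplies over `0 ≤ y ≤ q(|x|)`; the uniform-length form is the
tree's convention. [cite: FortnowRogers1999JCSS, Thm. 2.2(3) (arXiv numbering)] -/
theorem prod_mem_GapP {g : List Bool → ℤ} (hg : g ∈ GapP) {t : List Bool → List Bool} (ht : t ∈ FP) :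
    (fun v => ∏ j ∈ range (t v).length, g (boolPair v (ones j))) ∈ GapP := by
  obtain ⟨a, ha, b, hb, e⟩ := hg
  obtain ⟨B, hBP, hB⟩ := exists_bitSel
  obtain ⟨Od, Ev, hOdP, hEvP, hOE⟩ := exists_parityPat
  -- `π ⟨⟨v, c⟩, u⟩ = ⟨v, u⟩`
  obtain ⟨π, hπ⟩ : ∃ f : List Bool → List Bool, f = fanoutFn (fstF ∘ fstF) sndF := ⟨_, rfl⟩
  have hπFP : π ∈ FP := hπ ▸ fanoutFn_mem_FP (comp_mem_FP fstF_mem_FP fstF_mem_FP) sndF_mem_FP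
  have hπ_apply : ∀ v c u : List Bool, π (boolPair (boolPair v c) u) = boolPair v u := fun v c u => by
    simp [hπ, fanoutFn_apply]
  -- the selected half `φ`
  obtain ⟨φ, hφdef⟩ : ∃ φ : List Bool → ℕ, φ = fun u => if u ∈ B then b (π u) else a (π u) := ⟨_, rfl⟩
  have hφ : φ ∈ SharpP :=
    hφdef ▸ piecewise_mem_SharpP (comp_mem_SharpP hb hπFP) (comp_mem_SharpP ha hπFP) hBP
  have hφ_apply : ∀ (v c : List Bool) (j : ℕ), φ (boolPair (boolPair v c) (ones j)) =
      if c.getD j false = true then b (boolPair v (ones j)) else a (boolPair v (ones j)) := by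
    intro v c j
    have hj : (ones j).length = j := List.length_replicate
    rw [hφdef]
    show (if boolPair (boolPair v c) (ones j) ∈ B then b (π (boolPair (boolPair v c) (ones j)))
      else a (π (boolPair (boolPair v c) (ones j)))) = _
    rw [hπ_apply]
    by_cases hbit : c.getD j false = true
    · rw [if_pos ((hB _ _ _).2 (hj.symm ▸ hbit)), if_pos hbit]
    · rw [if_neg (fun h => hbit (hj ▸ (hB _ _ _).1 h)), if_neg hbit]
  -- its uniform product `P` over `j < |t v|`, a `#P` function of `⟨v, c⟩`
  obtain ⟨P, hPdef⟩ : ∃ P : List Bool → ℕ,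
      P = fun y => ∏ j ∈ range ((t ∘ fstF) y).length, φ (boolPair y (ones j)) := ⟨_, rfl⟩
  have hP : P ∈ SharpP := hPdef ▸ prod_mem_SharpP hφ (comp_mem_FP ht fstF_mem_FP)
  have hP_apply : ∀ v c : List Bool, (P (boolPair v c) : ℤ) = ∏ j ∈ range (t v).length,
      (if c.getD j false = true then (b (boolPair v (ones j)) : ℤ) else (a (boolPair v (ones j)) : ℤ)) := by
    intro v c
    rw [hPdef]
    show ((∏ j ∈ range ((t ∘ fstF) (boolPair v c)).length, φ (boolPair (boolPair v c) (ones j)) : ℕ) : ℤ) = _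
    rw [Function.comp_apply, fstF_boolPair, Nat.cast_prod]
    refine Finset.prod_congr rfl fun j _ => ?_
    rw [hφ_apply, Nat.cast_ite]
  -- the even and the odd patterns, summed separately
  refine ⟨_, sum_mem_SharpP (ite_mem_SharpP hP hEvP) ht, _, sum_mem_SharpP (ite_mem_SharpP hP hOdP) ht,
    fun v => ?_⟩
  have hE : ∀ c : List.Vector Bool (t v).length,
      ((if boolPair v c.toList ∈ Ev then P (boolPair v c.toList) else 0 : ℕ) : ℤ) -
        ((if boolPair v c.toList ∈ Od then P (boolPair v c.toList) else 0 : ℕ) : ℤ) =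
      (-1 : ℤ) ^ c.toList.count true * (P (boolPair v c.toList) : ℤ) := by
    intro c
    have hodd := (hOE v c.toList).1
    have heven := (hOE v c.toList).2
    rcases Nat.even_or_odd (c.toList.count true) with hev | hod
    · rw [if_pos (heven.2 (Nat.not_odd_iff_even.2 hev)),
        if_neg (fun h => Nat.not_odd_iff_even.2 hev (hodd.1 h)), hev.neg_one_pow]
      simp
    · rw [if_neg (fun h => heven.1 h hod), if_pos (hodd.2 hod), hod.neg_one_pow]
      simp
  have key := signedSum_prod_eq (t v).length
    (fun e j => if e = true then (b (boolPair v (ones j)) : ℤ) else (a (boolPair v (ones j)) : ℤ))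
  beta_reduce at key
  show ∏ j ∈ range (t v).length, g (boolPair v (ones j)) =
    ((∑ c : List.Vector Bool (t v).length,
        (if boolPair v c.toList ∈ Ev then P (boolPair v c.toList) else 0) : ℕ) : ℤ) -
      ((∑ c : List.Vector Bool (t v).length,
        (if boolPair v c.toList ∈ Od then P (boolPair v c.toList) else 0) : ℕ) : ℤ)
  rw [Nat.cast_sum, Nat.cast_sum, ← Finset.sum_sub_distrib, Finset.sum_congr rfl fun c _ => hE c]
  simp only [hP_apply]
  rw [key]
  refine Finset.prod_congr rfl fun j _ => ?_
  rw [if_neg Bool.false_ne_true, if_pos rfl]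
  exact e _

end GapPClosure

end Literature.Computability.QuantumComplexity

end
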